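import Literature.AlgebraicGeometry.HodgeTheory.PicardLefschetzSymmetricA3
import Literature.AlgebraicGeometry.HodgeTheory.UniversalHypersurfaceDiscriminantNodeChart
import HarnessLib

/-!
# The Hessian at a symmetric `A₃` point: kernel the plane `⟨e_j, e_k⟩`, injectivity on the complementary slice
# (programme B2-BIF, stage S0, for the binder hB2 `picardLefschetz_symmetricA3` of crux K1-B)

Family `hodge`, layer `Literature/AlgebraicGeometry/HodgeTheory`, next to `PicardLefschetzSymmetricA3` (the hypotheses
`IsSymmetricA3Datum f₁ g₀ g₂ j k a` of the named fact hB2 = `picardLefschetz_symmetricA3` of crux K1-B of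
`Summits/HodgeConjecture/HodgeConjecture/Theses/SignSymmetricPowers.lean`, stmt-HodgeConjecture-19716) and
`UniversalHypersurfaceDiscriminantNodeChart` (`DiscriminantBranches.hessianAt`, its symmetry and Euler identity).  Written by
the prover seat `hodge-nonav-prover-Bx` (g12, cell `hodge-nonav`): first brick of the programme B2-BIF (memo
`HOME/memos/PROGRAMME-B2BIF-Bx-g12.md`) towards the bifurcation half `IsSymmetricA3Bifurcation` of hB2 (AGZV II §5.2, boundary
singularity `B₂`).  The analysis of the two-parameter unfolding `f₁ + a g₂ + b g₀` near the `A₃` point `e_j` eliminates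
the non-degenerate directions `v = (x_i)_{i ∉ {j,k}}` by the implicit function theorem; its Jacobian is the Hessian of `f₁`
at `e_j` restricted to those directions, and this file proves that restriction is injective:

* `IsSymmetricA3Datum.hessianAt_mulVec_single_k`, `…_single_j` — `Hess(f₁)(e_j)` kills `e_k` (datum: `∂ᵢ∂ₖf₁(e_j) = 0`) and
  `e_j` (Euler);
* `IsSymmetricA3Datum.ker_hessianAt_eq_span` — `ker Hess(f₁)(e_j) = ⟨e_j, e_k⟩` (rank `n`);
* `IsSymmetricA3Datum.eq_zero_of_hessianAt_mulVec_eq_zero` — a vector with `v_j = v_k = 0` killed by the Hessian is zero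
  (the `v`-block of the Hessian is invertible — Voisin II §2.1.1 Lemma 2.7 "`pr₂` is an immersion" adapted to the `A₃`
  point: the splitting-lemma/implicit-function step of AGZV II §5.2 in the tree's coordinates).

## References
* [ArnoldGuseinzadeVarchenko2012] AGZV II, Part I §5.2 (boundary singularities `B_k`, pp. 129–133).
* [VoisinHodgeII2003] Voisin II, §2.1.1 Lemma 2.7, Cor. 2.8 (the Hessian at a singular point; Euler).
-/

noncomputable section

open MvPolynomial

namespace Literature.AlgebraicGeometry.HodgeTheory

section HodgeTheory

variable {n d : ℕ} {f₁ g₀ g₂ : MvPolynomial (Fin (n + 2)) ℂ} {j k : Fin (n + 2)} {a : Fin (n + 2) → ℂˣ}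

namespace IsSymmetricA3Datum

open DiscriminantBranches

/-- The Hessian of `f₁` at the `A₃` point `e_j` has rank `n`. [cite: ArnoldGuseinzadeVarchenko2012, Part I §5.2] -/
theorem rank_hessianAt (hD : IsSymmetricA3Datum f₁ g₀ g₂ j k a) :
    (hessianAt f₁ (Pi.single j 1)).rank = n :=
  hD.2.2.2.1

/-- `Hess(f₁)(e_j) · e_k = 0`: the kernel coordinate (datum `∂ᵢ∂ₖ f₁(e_j) = 0` for all `i`).
[cite: ArnoldGuseinzadeVarchenko2012, Part I §5.2] -/
theorem hessianAt_mulVec_single_k (hD : IsSymmetricA3Datum f₁ g₀ g₂ j k a) :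
    (hessianAt f₁ (Pi.single j 1)).mulVec (Pi.single k (1 : ℂ)) = 0 := by
  funext i
  rw [Pi.zero_apply, Matrix.mulVec, dotProduct, Finset.sum_eq_single k]
  · rw [Pi.single_eq_same, mul_one]
    exact hD.2.2.2.2.1 i
  · intro i' _ hi'
    rw [Pi.single_eq_of_ne hi', mul_zero]
  · exact fun h => (h (Finset.mem_univ k)).elim

/-- `Hess(f₁)(e_j) · e_j = 0` (Euler: `Hess · p = (d − 1) ∇f₁(p) = 0` at the singular point `p = e_j`).
[cite: VoisinHodgeII2003, §2.1.1 Cor. 2.8] -/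
theorem hessianAt_mulVec_single_j (hf₁ : f₁.IsHomogeneous d) (hD : IsSymmetricA3Datum f₁ g₀ g₂ j k a) :
    (hessianAt f₁ (Pi.single j 1)).mulVec (Pi.single j (1 : ℂ)) = 0 :=
  hessianAt_mulVec_self hf₁ hD.2.1

/-- **The kernel of the Hessian at the symmetric `A₃` point is the plane `⟨e_j, e_k⟩`** (rank `n`, and both
coordinate vectors are killed). [cite: ArnoldGuseinzadeVarchenko2012, Part I §5.2] [cite: VoisinHodgeII2003, §2.1.1 Lemma 2.7] -/
theorem ker_hessianAt_eq_span (hf₁ : f₁.IsHomogeneous d) (hD : IsSymmetricA3Datum f₁ g₀ g₂ j k a) :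
    LinearMap.ker (hessianAt f₁ (Pi.single j 1)).mulVecLin =
      Submodule.span ℂ {(Pi.single j (1 : ℂ) : Fin (n + 2) → ℂ), Pi.single k 1} := by
  classical
  have hjk : j ≠ k := hD.1
  have hrank : Module.finrank ℂ (LinearMap.range (hessianAt f₁ (Pi.single j (1 : ℂ))).mulVecLin) = n :=
    hD.rank_hessianAt
  have hsum := LinearMap.finrank_range_add_finrank_ker (hessianAt f₁ (Pi.single j (1 : ℂ))).mulVecLin
  rw [hrank, Module.finrank_fintype_fun_eq_card, Fintype.card_fin] at hsum
  have hker : Module.finrank ℂ (LinearMap.ker (hessianAt f₁ (Pi.single j (1 : ℂ))).mulVecLin) = 2 := by omega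
  have hle : Submodule.span ℂ {(Pi.single j (1 : ℂ) : Fin (n + 2) → ℂ), Pi.single k 1} ≤
      LinearMap.ker (hessianAt f₁ (Pi.single j 1)).mulVecLin := by
    rw [Submodule.span_le]
    intro v hv
    rcases hv with rfl | hv
    · rw [SetLike.mem_coe, LinearMap.mem_ker, Matrix.mulVecLin_apply]; exact hD.hessianAt_mulVec_single_j hf₁
    · rw [Set.mem_singleton_iff] at hv
      rw [hv, SetLike.mem_coe, LinearMap.mem_ker, Matrix.mulVecLin_apply]; exact hD.hessianAt_mulVec_single_k
  -- the two coordinate vectors are linearly independent, so the span has dimension `2`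
  have hli : LinearIndependent ℂ ![(Pi.single j (1 : ℂ) : Fin (n + 2) → ℂ), Pi.single k 1] := by
    refine LinearIndependent.pair_iff.2 fun s t hst => ?_
    have hj' := congr_fun hst j
    have hk' := congr_fun hst k
    simp only [Pi.add_apply, Pi.smul_apply, Pi.single_apply, if_true, if_neg hjk.symm, if_neg hjk, smul_eq_mul,
      mul_one, mul_zero, add_zero, zero_add, Pi.zero_apply] at hj' hk'
    exact ⟨hj', hk'⟩
  have hspan2 : Module.finrank ℂ (Submodule.span ℂ {(Pi.single j (1 : ℂ) : Fin (n + 2) → ℂ), Pi.single k 1}) = 2 := by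
    have h := finrank_span_eq_card hli
    have hr : Set.range ![(Pi.single j (1 : ℂ) : Fin (n + 2) → ℂ), Pi.single k 1] =
        {(Pi.single j (1 : ℂ) : Fin (n + 2) → ℂ), Pi.single k 1} := by
      rw [Matrix.range_cons, Matrix.range_cons, Matrix.range_empty, Set.union_empty, Set.singleton_union]
    rw [hr, Fintype.card_fin] at h
    exact h
  refine (Submodule.eq_of_le_of_finrank_eq hle ?_).symm
  rw [hker, hspan2]

/-- **The Hessian at the symmetric `A₃` point is injective on the slice `v_j = v_k = 0`**: the `v`-block
`(∂ᵢ∂ᵢ' f₁(e_j))_{i,i' ∉ {j,k}}` is invertible — the Jacobian of the implicit-function step eliminating the non-degenerate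
directions in AGZV II §5.2. [cite: ArnoldGuseinzadeVarchenko2012, Part I §5.2] [cite: VoisinHodgeII2003, §2.1.1 Lemma 2.7] -/
theorem eq_zero_of_hessianAt_mulVec_eq_zero (hf₁ : f₁.IsHomogeneous d) (hD : IsSymmetricA3Datum f₁ g₀ g₂ j k a)
    {v : Fin (n + 2) → ℂ} (hvj : v j = 0) (hvk : v k = 0) (hv : (hessianAt f₁ (Pi.single j 1)).mulVec v = 0) :
    v = 0 := by
  classical
  have hjk : j ≠ k := hD.1
  have hmem : v ∈ LinearMap.ker (hessianAt f₁ (Pi.single j (1 : ℂ))).mulVecLin := by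
    rw [LinearMap.mem_ker, Matrix.mulVecLin_apply]; exact hv
  rw [hD.ker_hessianAt_eq_span hf₁, Submodule.mem_span_pair] at hmem
  obtain ⟨s, t, hst⟩ := hmem
  have hj' := congr_fun hst j
  have hk' := congr_fun hst k
  simp only [Pi.add_apply, Pi.smul_apply, Pi.single_apply, if_true, if_neg hjk.symm, if_neg hjk, smul_eq_mul,
    mul_one, mul_zero, add_zero, zero_add, hvj, hvk] at hj' hk'
  rw [← hst, hj', hk', zero_smul, zero_smul, add_zero]

/-- The same with the equations written out: `v_j = v_k = 0` and `Σ_{i'} ∂ᵢ∂ᵢ' f₁(e_j) v_{i'} = 0` for all `i` force `v = 0`.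
[cite: ArnoldGuseinzadeVarchenko2012, Part I §5.2] -/
theorem eq_zero_of_sum_hessian_mul_eq_zero (hf₁ : f₁.IsHomogeneous d) (hD : IsSymmetricA3Datum f₁ g₀ g₂ j k a)
    {v : Fin (n + 2) → ℂ} (hvj : v j = 0) (hvk : v k = 0)
    (hv : ∀ i, ∑ i', eval (Pi.single j (1 : ℂ)) (pderiv i (pderiv i' f₁)) * v i' = 0) : v = 0 := by
  refine hD.eq_zero_of_hessianAt_mulVec_eq_zero hf₁ hvj hvk ?_
  funext i
  simpa [Matrix.mulVec, dotProduct, hessianAt] using hv i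

/-! ### §S1 (appended) The slice chart: elimination of the non-degenerate directions by the implicit function theorem -/

open Literature.AlgebraicGeometry.Motives.UniversalHypersurface
open Literature.NumberTheory.Transcendental (exists_implicitChart)

/-- **The Jacobian of the slice system is invertible.**  At the symmetric `A₃` point `e_j` of `f₁` (degree `d`), the
square system «`∂ᵢ F_c(x) = 0` for `i ∉ {j, k}`, `x_j = 1`» in the unknowns `(x_i)_{i ≠ k}` (the free variables being
`x_k` and the coefficients `c`) has invertible Jacobian at `(e_j, coeffsOf f₁)`: a kernel vector `v` (with `v_k := 0`)
satisfies `v_j = 0` and `Hess · v = 0` off the row `j`, on the row `k` by the datum, and on the row `j` by Euler, hence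
`v = 0` (`eq_zero_of_sum_hessian_mul_eq_zero`). [cite: ArnoldGuseinzadeVarchenko2012, Part I §5.2]
[cite: VoisinHodgeII2003, §2.1.1 Lemma 2.7] -/
theorem det_sliceJacobian_ne_zero (hf₁ : f₁.IsHomogeneous d) (hD : IsSymmetricA3Datum f₁ g₀ g₂ j k a) :
    (Matrix.of fun i i' : {i : Fin (n + 2) // i ≠ k} =>
      eval (Sum.elim (Pi.single j (1 : ℂ)) (coeffsOf n d f₁))
        (pderiv (Sum.inl i.1 : JVar n d)
          (if i'.1 = j then X (Sum.inl j) - C 1 else pderiv (Sum.inl i'.1) (jointForm n d)))).det ≠ 0 := by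
  classical
  have hjk : j ≠ k := hD.1
  have hform : formOfCoeffs (coeffsOf n d f₁) = f₁ := formOfCoeffs_coeffsOf _ _ hf₁
  set z₀ : JVar n d → ℂ := Sum.elim (Pi.single j (1 : ℂ)) (coeffsOf n d f₁) with hz₀
  set H : Fin (n + 2) → Fin (n + 2) → ℂ := fun i i' => eval (Pi.single j (1 : ℂ)) (pderiv i (pderiv i' f₁)) with hH
  -- the entries of the Jacobian
  have hentry : ∀ i i' : {i : Fin (n + 2) // i ≠ k},
      eval z₀ (pderiv (Sum.inl i.1 : JVar n d)
          (if i'.1 = j then X (Sum.inl j) - C 1 else pderiv (Sum.inl i'.1) (jointForm n d))) =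
      if i'.1 = j then (if i.1 = j then 1 else 0) else H i.1 i'.1 := by
    intro i i'
    by_cases h1 : i'.1 = j
    · rw [if_pos h1, if_pos h1, map_sub, pderiv_C, sub_zero, pderiv_X]
      by_cases h2 : i.1 = j
      · rw [if_pos h2, h2, Pi.single_eq_same, map_one]
      · rw [if_neg h2, Pi.single_apply, if_neg (fun h' => h2 (Sum.inl_injective h').symm), map_zero]
    · rw [if_neg h1, if_neg h1, hz₀, eval_pderiv_inl_pderiv_inl_jointForm, hform]
  set M : Matrix {i : Fin (n + 2) // i ≠ k} {i : Fin (n + 2) // i ≠ k} ℂ := Matrix.of fun i i' =>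
      eval z₀ (pderiv (Sum.inl i.1 : JVar n d)
        (if i'.1 = j then X (Sum.inl j) - C 1 else pderiv (Sum.inl i'.1) (jointForm n d))) with hM
  intro hdet
  rw [← Matrix.det_transpose] at hdet
  obtain ⟨v, hv0, hv⟩ := Matrix.exists_mulVec_eq_zero_iff.2 hdet
  -- the equations, entrywise: for each equation index `i'`, `Σ_i M i i' v i = 0`
  have heq : ∀ i' : {i : Fin (n + 2) // i ≠ k},
      ∑ i, (if i'.1 = j then (if i.1 = j then (1 : ℂ) else 0) else H i.1 i'.1) * v i = 0 := by
    intro i'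
    have h1 := congr_fun hv i'
    rw [Pi.zero_apply, Matrix.mulVec, dotProduct] at h1
    refine (Finset.sum_congr rfl fun i _ => ?_).trans h1
    rw [Matrix.transpose_apply, hM, Matrix.of_apply, hentry i i']
  -- `v_j = 0`
  have hvj : v ⟨j, hjk⟩ = 0 := by
    have h := heq ⟨j, hjk⟩
    simp only [if_true] at h
    rw [Finset.sum_eq_single ⟨j, hjk⟩] at h
    · simpa using h
    · intro i _ hi
      have : i.1 ≠ j := fun h' => hi (Subtype.ext h')
      rw [if_neg this, zero_mul]
    · exact fun h' => (h' (Finset.mem_univ _)).elim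
  -- extend `v` by `0` at `k`
  let V : Fin (n + 2) → ℂ := fun i => if h : i = k then 0 else v ⟨i, h⟩
  have hVk : V k = 0 := by simp [V]
  have hVne : ∀ (i : Fin (n + 2)) (h : i ≠ k), V i = v ⟨i, h⟩ := fun i h => by simp [V, h]
  have hVj : V j = 0 := by rw [hVne j hjk, hvj]
  have hsumV : ∀ g : Fin (n + 2) → ℂ, ∑ i : {i : Fin (n + 2) // i ≠ k}, g i.1 * v i = ∑ i, g i * V i := by
    intro g
    have h1 : ∑ i : {i : Fin (n + 2) // i ≠ k}, g i.1 * v i = ∑ i : {i : Fin (n + 2) // i ≠ k}, g i.1 * V i.1 :=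
      Finset.sum_congr rfl fun i _ => by rw [hVne i.1 i.2]
    rw [h1, ← Finset.sum_subtype (Finset.univ.filter fun i : Fin (n + 2) => i ≠ k) (by simp) (fun i => g i * V i)]
    refine Finset.sum_subset (Finset.filter_subset _ _) fun i _ hi => ?_
    have hik : i = k := by simpa using hi
    rw [hik, hVk, mul_zero]
  -- the Hessian equations off the rows `j`, `k`
  have hHoff : ∀ i' : Fin (n + 2), i' ≠ j → i' ≠ k → ∑ i, H i i' * V i = 0 := by
    intro i' hi'j hi'k
    have h := heq ⟨i', hi'k⟩
    simp only [hi'j, if_false] at h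
    rwa [hsumV (fun i => H i i')] at h
  -- row `k`: the datum
  have hHk : ∑ i, H i k * V i = 0 :=
    Finset.sum_eq_zero fun i _ => by rw [hH]; dsimp only; rw [hD.2.2.2.2.1 i, zero_mul]
  -- row `j`: Euler `Σ_{i'} ∂_i∂_{i'} f₁(e_j) (e_j)_{i'} = Σ_{i'} (e_j)_{i'} ∂_{i'}∂_i f₁ (e_j) = (d-1) ∂_i f₁(e_j) = 0`
  have hHj : ∑ i, H i j * V i = 0 := by
    have hrow : ∀ i, H i j = 0 := by
      intro i
      have hEu := congrArg (eval (Pi.single j (1 : ℂ) : Fin (n + 2) → ℂ)) (hf₁.pderiv (i := i)).sum_X_mul_pderiv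
      rw [map_sum, map_nsmul, hD.2.1 i, smul_zero] at hEu
      simp only [map_mul, eval_X] at hEu
      rw [Finset.sum_eq_single j] at hEu
      · rw [Pi.single_eq_same, one_mul] at hEu
        rw [hH]; dsimp only
        rw [show eval (Pi.single j (1 : ℂ)) (pderiv i (pderiv j f₁)) = hessianAt f₁ (Pi.single j 1) i j from rfl,
          hessianAt_comm]
        exact hEu
      · intro i' _ hi'
        rw [Pi.single_eq_of_ne hi', zero_mul]
      · exact fun h' => (h' (Finset.mem_univ _)).elim
    exact Finset.sum_eq_zero fun i _ => by rw [hrow i, zero_mul]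
  have hV0 : V = 0 := hD.eq_zero_of_sum_hessian_mul_eq_zero hf₁ hVj hVk fun i' => by
    have hsymm : ∀ i, eval (Pi.single j (1 : ℂ)) (pderiv i' (pderiv i f₁)) = H i i' := fun i => by
      rw [hH]; dsimp only
      exact hessianAt_comm f₁ (Pi.single j 1) i' i
    simp_rw [hsymm]
    by_cases h1 : i' = j
    · rw [h1]; exact hHj
    · by_cases h2 : i' = k
      · rw [h2]; exact hHk
      · exact hHoff i' h1 h2
  apply hv0
  funext i
  rw [← hVne i.1 i.2, hV0, Pi.zero_apply, Pi.zero_apply]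

/-- **The slice chart at the symmetric `A₃` point** (the implicit-function step of AGZV II §5.2 in the universal
coefficient coordinates, via the tree's `exists_implicitChart`).  There are open sets `T ∋ (0, coeffsOf f₁)` (free variables:
the kernel coordinate `u = x_k` and the coefficient vector `c`) and `Ω ∋ (e_j, coeffsOf f₁)` (joint space), and a map `ψ`
analytic on `T`, with: for `w = (u, c) ∈ T`, `ψ w = (x, c) ∈ Ω` has `x_j = 1`, `x_k = u` and `∂ᵢ F_c(x) = 0` for all
`i ∉ {j, k}`; `ψ (0, coeffsOf f₁) = (e_j, coeffsOf f₁)`; and UNIQUENESS — every `(x, c) ∈ Ω` with `x_j = 1` and those partials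
zero equals `ψ (x_k, c)` with `(x_k, c) ∈ T`.  [cite: ArnoldGuseinzadeVarchenko2012, Part I §5.2]
[cite: VoisinHodgeII2003, §2.1.1 Lemma 2.7] -/
theorem exists_sliceChart (hf₁ : f₁.IsHomogeneous d) (hD : IsSymmetricA3Datum f₁ g₀ g₂ j k a) :
    ∃ (T : Set (Unit ⊕ DegIndex n d → ℂ)) (Ω : Set (JVar n d → ℂ))
      (ψ : (Unit ⊕ DegIndex n d → ℂ) → (JVar n d → ℂ)),
      IsOpen T ∧ IsOpen Ω ∧ Sum.elim (Pi.single j (1 : ℂ)) (coeffsOf n d f₁) ∈ Ω ∧ AnalyticOnNhd ℂ ψ T ∧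
      Sum.elim (fun _ : Unit => (0 : ℂ)) (coeffsOf n d f₁) ∈ T ∧
      ψ (Sum.elim (fun _ : Unit => (0 : ℂ)) (coeffsOf n d f₁)) = Sum.elim (Pi.single j (1 : ℂ)) (coeffsOf n d f₁) ∧
      (∀ w ∈ T, ψ w ∈ Ω ∧ prA n d (ψ w) = (fun m => w (Sum.inr m)) ∧ ψ w (Sum.inl k) = w (Sum.inl ()) ∧
        ψ w (Sum.inl j) = 1 ∧
        ∀ i, i ≠ j → i ≠ k → eval (prX n d (ψ w)) (pderiv i (formOfCoeffs (prA n d (ψ w)))) = 0) ∧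
      (∀ z ∈ Ω, z (Sum.inl j) = 1 →
        (∀ i, i ≠ j → i ≠ k → eval (prX n d z) (pderiv i (formOfCoeffs (prA n d z))) = 0) →
        Sum.elim (fun _ : Unit => z (Sum.inl k)) (fun m => z (Sum.inr m)) ∈ T ∧
          ψ (Sum.elim (fun _ : Unit => z (Sum.inl k)) (fun m => z (Sum.inr m))) = z) := by
  classical
  have hjk : j ≠ k := hD.1
  set z₀ : JVar n d → ℂ := Sum.elim (Pi.single j (1 : ℂ)) (coeffsOf n d f₁) with hz₀
  -- the splitting of the joint variables: free `(x_k, c)`, unknowns `(x_i)_{i ≠ k}`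
  let E : ((Unit ⊕ DegIndex n d) ⊕ {i : Fin (n + 2) // i ≠ k}) ≃ JVar n d :=
    { toFun := fun v => match v with
        | Sum.inl (Sum.inl _) => Sum.inl k
        | Sum.inl (Sum.inr m) => Sum.inr m
        | Sum.inr i => Sum.inl i.1
      invFun := fun v => match v with
        | Sum.inl i => if h : i = k then Sum.inl (Sum.inl ()) else Sum.inr ⟨i, h⟩
        | Sum.inr m => Sum.inl (Sum.inr m)
      left_inv := by
        rintro ((_ | m) | ⟨i, hi⟩)
        · simp
        · simp
        · simp [hi]
      right_inv := by
        rintro (i | m)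
        · by_cases h : i = k
          · subst h; simp
          · simp [h]
        · simp }
  let F : {i : Fin (n + 2) // i ≠ k} → MvPolynomial (JVar n d) ℂ := fun i' =>
    if i'.1 = j then X (Sum.inl j) - C 1 else pderiv (Sum.inl i'.1) (jointForm n d)
  -- the system and its meaning
  have hsys : ∀ z : JVar n d → ℂ, (∀ i', eval z (F i') = 0) ↔
      (z (Sum.inl j) = 1 ∧ ∀ i, i ≠ j → i ≠ k → eval (prX n d z) (pderiv i (formOfCoeffs (prA n d z))) = 0) := by
    intro z
    constructor
    · intro hz
      refine ⟨?_, fun i hij hik => ?_⟩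
      · have := hz ⟨j, hjk⟩
        simp only [F, if_true, map_sub, eval_X, eval_C] at this
        exact sub_eq_zero.1 this
      · have := hz ⟨i, hik⟩
        simp only [F, hij, if_false] at this
        rw [← sumElim_prX_prA z, eval_pderiv_inl_jointForm] at this
        simpa using this
    · rintro ⟨h0, hrest⟩ ⟨i, hik⟩
      by_cases hij : i = j
      · subst hij; simp [F, h0]
      · simp only [F, hij, if_false]
        rw [← sumElim_prX_prA z, eval_pderiv_inl_jointForm]
        simpa using hrest i hij hik
  have hJ : (Matrix.of fun i i' : {i : Fin (n + 2) // i ≠ k} => eval z₀ (pderiv (E (Sum.inr i)) (F i'))).det ≠ 0 :=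
    det_sliceJacobian_ne_zero hf₁ hD
  obtain ⟨Ω, T, ψ, hΩ, hz₀Ω, hT, hψ, hzero, hgraph⟩ := exists_implicitChart E F z₀ hJ
  -- the free coordinates of a joint point
  have hfree : ∀ z : JVar n d → ℂ,
      (fun t : Unit ⊕ DegIndex n d => z (E (Sum.inl t))) = Sum.elim (fun _ : Unit => z (Sum.inl k)) (fun m => z (Sum.inr m)) := by
    intro z; funext t; rcases t with _ | m <;> rfl
  have hz₀sys : ∀ i', eval z₀ (F i') = 0 := by
    rw [hsys]
    refine ⟨by simp [hz₀], fun i hij hik => ?_⟩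
    simp only [hz₀, prX_apply, prA_apply, Sum.elim_inl, Sum.elim_inr]
    rw [show (fun m => coeffsOf n d f₁ m) = coeffsOf n d f₁ from rfl, formOfCoeffs_coeffsOf _ _ hf₁,
      show (fun j' => (Pi.single j (1 : ℂ) : Fin (n + 2) → ℂ) j') = Pi.single j 1 from rfl]
    exact hD.2.1 i
  have hz₀free : Sum.elim (fun _ : Unit => z₀ (Sum.inl k)) (fun m => z₀ (Sum.inr m)) =
      Sum.elim (fun _ : Unit => (0 : ℂ)) (coeffsOf n d f₁) := by
    funext t; rcases t with _ | m
    · simp [hz₀, Pi.single_eq_of_ne hjk.symm]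
    · simp [hz₀]
  obtain ⟨hz₀T, hψz₀⟩ := hzero z₀ hz₀Ω hz₀sys
  rw [hfree, hz₀free] at hz₀T hψz₀
  refine ⟨T, Ω, ψ, hT, hΩ, hz₀Ω, hψ, hz₀T, hψz₀, fun w hw => ?_, fun z hz h0 hrest => ?_⟩
  · obtain ⟨hΩw, heqs, hproj⟩ := hgraph w hw
    have hk' : ψ w (Sum.inl k) = w (Sum.inl ()) := congr_fun hproj (Sum.inl ())
    have hA' : prA n d (ψ w) = fun m => w (Sum.inr m) := by
      funext m; exact congr_fun hproj (Sum.inr m)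
    obtain ⟨hj', hpart⟩ := (hsys (ψ w)).1 heqs
    exact ⟨hΩw, hA', hk', hj', hpart⟩
  · have heqs : ∀ i', eval z (F i') = 0 := (hsys z).2 ⟨h0, hrest⟩
    obtain ⟨hzT, hψz⟩ := hzero z hz heqs
    rw [hfree] at hzT hψz
    exact ⟨hzT, hψz⟩

end IsSymmetricA3Datum

end HodgeTheory

end Literature.AlgebraicGeometry.HodgeTheory

end
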